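/-
Copyright (c) 2026. All rights reserved.
Released under Apache 2.0 license as described in the file LICENSE.
-/
import Summits.NavierStokesRegularity.FluidComputer.RowCircuitReentry
import Summits.NavierStokesRegularity.FluidComputer.RowCircuitCascade
import HarnessLib

/-!
# The toy machine: the induction step iterated — infinitely many windows in finite time

HONEST FRAMING (cell `pub-fluidc`, blueprint seat bp3, gen 23): low prior, high value-of-information
experiment on Tao's machine paradigm; NOT a claim that NS blows up. Everything here concerns the
9-mode TOY chain `F gK ΛK` (R1-DESIGN §7–§12); nothing is claimed about Navier–Stokes.

THE CASCADE BOOKKEEPING THEOREM (R1-DESIGN §12.6 (3)). Given the re-entry certificate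
`hre : reentryOK (row 0) reBox = true` (one `native_decide` on the chain of record, see
`RowCircuitReentry`), an arbitrary ("adversarial") sequence of QUIET fresh-mode choices
`qm n ∈ Q1C ± Q1W` (interface axiom (Q)), a start state `s₀ ∈ reBox` and a physical amplitude
`A₀ > 0`, the induction step `induction_step_of` is iterated by recursion into a MACHINE RUN:

* `traj n ∈ reBox` — the renormalised start state of window `n`; `ysol n`, `τs n` — the exact
  unit-scale circuit solution from it and its section time `|τs n − 19/20| ≤ 3/500`;
  `traj (n+1) = renorm (ysol n (τs n)) (qm n)` (`traj_succ`);
* `lev n = a₂(τs n)/X0 0 ∈ [levLo, levHi] = [0.9673, 0.9718]` — the level of window `n`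
  (`lev_bounds`), `amp (n+1) = amp n · lev n`, `amp 0 = A₀` — the physical amplitudes;
* `win n t = amp n • ysol n (amp n · ΛKⁿ · t)` — the PHYSICAL window `n`: it solves the scale-`n`
  equations `ẇ = ΛKⁿ • F(w)` (`win_solves`, the model's exact scaling symmetry
  `solution_smul/speed`), starts at `amp n • traj n` (`win_start`), conserves `∑ wₐ²`
  (`win_energy`), and lasts `dur n = τs n /(amp n · ΛKⁿ)`;
* HAND-OVER CONSISTENCY (`handover`, `handover_fresh`): the first gate of window `n+1` at its
  start IS, slot by slot and in physical units, the second gate of window `n` at its section time,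
  and the fresh second gate of window `n+1` starts at `amp (n+1) • qm n`;
* FINITE TIME, UNBOUNDED LEVEL-WEIGHTED AMPLITUDE: the machine clock `clock N = ∑_{n<N} dur n`
  satisfies `clock N ≤ (6/5)/A₀` for every `N` (`clock_le`), while `ΛKⁿ · amp n ≥ A₀ · 5ⁿ`
  (`growth`) — infinitely many windows, each moving the active modes one factor `ΛK` up in
  frequency, complete in physical time `≤ 1.2/A₀`.

This is the toy counterpart of `Literature…CascadeWitness` (summable gadget times ⇒ finite
lifespan): the "stated norm" that blows up is the level-weighted amplitude `ΛKⁿ · amp n` at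
machine time `clock n < 1.2/A₀`. Energy is NOT claimed to concentrate: each hand-over leaves the
old first gate behind (a fraction `1 − lev² ≈ 6 %` per level stays at level `n`, decoupled in the
toy) — exactly the leakage the interface ledger of ASSEMBLY.md item 11 books.
COMPUTATIONAL (transitively `Lean.ofReduceBool` through the chain cone). No `sorry`, no new axioms.
-/

namespace Summit.NavierStokesRegularity.FluidComputer
open Literature.Analysis.FluidPDE.FluidComputer
namespace RowChain
open RowCheck RowCheck.RowData RowRun ChainField Finset

/-- States of the re-entry box `reBox`. [folklore] -/
def ReState : Type := {q : Fin 9 → ℝ // ∀ b, |q b - (reBox.cen b : ℝ)| ≤ reBox.rad b}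

/-- **Machine data**: the re-entry certificate, a quiet fresh-mode environment, a start state and
a physical amplitude. [folklore] -/
structure MachineData where
  /-- the re-entry certificate of the chain of record -/
  hre : reentryOK (row 0) reBox = true
  /-- the fresh second-gate modes chosen at hand-over `n` (level-normalised) -/
  qm : ℕ → Fin 4 → ℝ
  /-- interface axiom (Q): every choice is quiet -/
  hqm : ∀ n m, |qm n m - (Q1C m : ℝ)| ≤ Q1W m
  /-- the start state of window `0` -/
  s₀ : ReState
  /-- the physical amplitude of window `0` -/
  A₀ : ℝ
  hA₀ : 0 < A₀

/-- The induction step, packed for `Classical.choose`. [folklore] -/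
theorem step_spec (hre : reentryOK (row 0) reBox = true) (s : ReState) :
    ∃ p : (ℝ → Fin 9 → ℝ) × ℝ, p.1 0 = s.1 ∧ (∀ σ, HasDerivAt p.1 (F gK ΛK (p.1 σ)) σ) ∧
      |p.2 - 19 / 20| ≤ 3 / 500 ∧ 0 < p.1 p.2 4 ∧ p.1 p.2 5 = (secCert.rho : ℝ) * p.1 p.2 4 ∧
      ((secCert.levLo : ℝ) ≤ p.1 p.2 5 / secCert.bmid ∧ p.1 p.2 5 / secCert.bmid ≤ secCert.levHi) ∧
      ∀ qm : Fin 4 → ℝ, (∀ m, |qm m - (Q1C m : ℝ)| ≤ Q1W m) →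
        ∀ b, |renorm (p.1 p.2) qm b - (reBox.cen b : ℝ)| ≤ reBox.rad b := by
  obtain ⟨y, hy0, hsol, τ, hτ, h4, hsec, hlev, hre'⟩ := induction_step_of hre s.1 s.2
  exact ⟨(y, τ), hy0, hsol, hτ, h4, hsec, hlev, hre'⟩

/-- One step's data (solution, section time), chosen. [folklore] -/
noncomputable def stepData (hre : reentryOK (row 0) reBox = true) (s : ReState) :
    (ℝ → Fin 9 → ℝ) × ℝ :=
  Classical.choose (step_spec hre s)

/-- [folklore] -/
theorem stepData_spec (hre : reentryOK (row 0) reBox = true) (s : ReState) :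
    (stepData hre s).1 0 = s.1 ∧ (∀ σ, HasDerivAt (stepData hre s).1 (F gK ΛK ((stepData hre s).1 σ)) σ) ∧
      |(stepData hre s).2 - 19 / 20| ≤ 3 / 500 ∧ 0 < (stepData hre s).1 (stepData hre s).2 4 ∧
      (stepData hre s).1 (stepData hre s).2 5 = (secCert.rho : ℝ) * (stepData hre s).1 (stepData hre s).2 4 ∧
      ((secCert.levLo : ℝ) ≤ (stepData hre s).1 (stepData hre s).2 5 / secCert.bmid ∧
        (stepData hre s).1 (stepData hre s).2 5 / secCert.bmid ≤ secCert.levHi) ∧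
      ∀ qm : Fin 4 → ℝ, (∀ m, |qm m - (Q1C m : ℝ)| ≤ Q1W m) →
        ∀ b, |renorm ((stepData hre s).1 (stepData hre s).2) qm b - (reBox.cen b : ℝ)| ≤ reBox.rad b :=
  Classical.choose_spec (step_spec hre s)

/-- [folklore] -/
theorem X0_zero_pos : 0 < X0 0 := by
  have h : (0 : ℚ) < X0Q 0 := by native_decide
  rw [X0_eq]; exact_mod_cast h

/-- `ΛK ≥ 5.6`. [folklore] -/
theorem ΛK_ge : (28 : ℝ) / 5 ≤ ΛK := by
  have h : (28 : ℚ) / 5 ≤ ΛQ := by rw [ΛQ]; norm_num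
  have h' := (Rat.cast_le (K := ℝ)).mpr h
  rw [ΛK]; push_cast at h'; exact h'

namespace MachineData
variable (M : MachineData)
/-- **The renormalised trajectory** of window start states, by recursion on the induction step.
[folklore] -/
noncomputable def traj : ℕ → ReState
  | 0 => M.s₀
  | n + 1 => ⟨renorm ((stepData M.hre (traj n)).1 (stepData M.hre (traj n)).2) (M.qm n),
      (stepData_spec M.hre (traj n)).2.2.2.2.2.2 (M.qm n) (M.hqm n)⟩

/-- The unit-scale exact circuit solution of window `n`. [folklore] -/
noncomputable def ysol (n : ℕ) : ℝ → Fin 9 → ℝ := (stepData M.hre (M.traj n)).1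

/-- The (unit-scale) section time of window `n`. [folklore] -/
noncomputable def τs (n : ℕ) : ℝ := (stepData M.hre (M.traj n)).2

/-- The level of window `n`: `a₂` at the section over the designed carrier `X0 0`. [folklore] -/
noncomputable def lev (n : ℕ) : ℝ := M.ysol n (M.τs n) 4 / X0 0

/-- The physical amplitude of window `n`. [folklore] -/
noncomputable def amp : ℕ → ℝ
  | 0 => M.A₀
  | n + 1 => amp n * M.lev n

/-- The physical duration of window `n`. [folklore] -/
noncomputable def dur (n : ℕ) : ℝ := M.τs n / (M.amp n * ΛK ^ n)

/-- The machine clock: physical start time of window `N`. [folklore] -/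
noncomputable def clock : ℕ → ℝ
  | 0 => 0
  | n + 1 => clock n + M.dur n

/-- **The physical window `n`**: amplitude `amp n`, frequency scale `ΛKⁿ`. [folklore] -/
noncomputable def win (n : ℕ) (t : ℝ) : Fin 9 → ℝ := M.amp n • M.ysol n (M.amp n * (ΛK ^ n * t))

/-! ### The renormalised run -/

/-- [folklore] -/
theorem traj_mem (n : ℕ) : ∀ b, |(M.traj n).1 b - (reBox.cen b : ℝ)| ≤ reBox.rad b := (M.traj n).2

/-- [folklore] -/
theorem traj_zero : M.traj 0 = M.s₀ := rfl

/-- [folklore] -/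
theorem traj_succ (n : ℕ) : (M.traj (n + 1)).1 = renorm (M.ysol n (M.τs n)) (M.qm n) := rfl

/-- [folklore] -/
theorem ysol_start (n : ℕ) : M.ysol n 0 = (M.traj n).1 := (stepData_spec M.hre (M.traj n)).1

/-- [folklore] -/
theorem ysol_solves (n : ℕ) : ∀ σ, HasDerivAt (M.ysol n) (F gK ΛK (M.ysol n σ)) σ :=
  (stepData_spec M.hre (M.traj n)).2.1

/-- [folklore] -/
theorem τs_window (n : ℕ) : |M.τs n - 19 / 20| ≤ 3 / 500 := (stepData_spec M.hre (M.traj n)).2.2.1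

/-- [folklore] -/
theorem a₂_pos (n : ℕ) : 0 < M.ysol n (M.τs n) 4 := (stepData_spec M.hre (M.traj n)).2.2.2.1

/-- Window `n` ends ON the section `b₂ = ρ a₂`. [folklore] -/
theorem on_section (n : ℕ) : M.ysol n (M.τs n) 5 = (secCert.rho : ℝ) * M.ysol n (M.τs n) 4 :=
  (stepData_spec M.hre (M.traj n)).2.2.2.2.1

/-- On the section the certificate's level `b₂/bmid` is `a₂/X0 0`. [folklore] -/
theorem level_eq (n : ℕ) : M.ysol n (M.τs n) 5 / secCert.bmid = M.lev n := by
  have h0 : ((X0Q 0 : ℚ) : ℝ) ≠ 0 := by exact_mod_cast X0Q_ne.1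
  have h1 : ((X0Q 1 : ℚ) : ℝ) ≠ 0 := by exact_mod_cast X0Q_ne.2
  have hr : (secCert.rho : ℝ) = (X0Q 1 : ℝ) / X0Q 0 := by
    show ((X0Q 1 / X0Q 0 : ℚ) : ℝ) = _; push_cast; rfl
  have hb : (secCert.bmid : ℝ) = (X0Q 1 : ℝ) := rfl
  rw [lev, M.on_section n, hr, hb, X0_eq]
  field_simp

/-- **Level bounds** `0.9673 ≤ lev n ≤ 0.9718`. [folklore] -/
theorem lev_bounds (n : ℕ) : (9673 : ℝ) / 10000 ≤ M.lev n ∧ M.lev n ≤ 9718 / 10000 := by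
  have h := (stepData_spec M.hre (M.traj n)).2.2.2.2.2.1
  rw [show (stepData M.hre (M.traj n)).1 = M.ysol n from rfl,
    show (stepData M.hre (M.traj n)).2 = M.τs n from rfl, M.level_eq n] at h
  have hlo : ((secCert.levLo : ℚ) : ℝ) = 9673 / 10000 := by
    show (((9673 : ℚ) / 10000 : ℚ) : ℝ) = _; push_cast; rfl
  have hhi : ((secCert.levHi : ℚ) : ℝ) = 9718 / 10000 := by
    show (((9718 : ℚ) / 10000 : ℚ) : ℝ) = _; push_cast; rfl
  rw [hlo, hhi] at h
  exact h

/-- [folklore] -/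
theorem lev_pos (n : ℕ) : 0 < M.lev n := by
  have := (M.lev_bounds n).1; linarith

/-! ### Amplitudes, durations, the clock -/

/-- [folklore] -/
theorem amp_zero : M.amp 0 = M.A₀ := rfl

/-- [folklore] -/
theorem amp_succ (n : ℕ) : M.amp (n + 1) = M.amp n * M.lev n := rfl

/-- [folklore] -/
theorem amp_pos (n : ℕ) : 0 < M.amp n := by
  induction n with
  | zero => exact M.hA₀
  | succ n ih => rw [amp_succ]; exact mul_pos ih (M.lev_pos n)

/-- `amp n ≥ A₀ · 0.9673ⁿ`. [folklore] -/
theorem amp_ge (n : ℕ) : M.A₀ * ((9673 : ℝ) / 10000) ^ n ≤ M.amp n := by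
  induction n with
  | zero => simp [amp_zero]
  | succ n ih =>
    rw [amp_succ, pow_succ, ← mul_assoc]
    exact mul_le_mul ih (M.lev_bounds n).1 (by positivity) (M.amp_pos n).le

/-- `amp n ≤ A₀ · 0.9718ⁿ` (the physical amplitude DEcreases: a fraction of the energy is left
behind at every level). [folklore] -/
theorem amp_le (n : ℕ) : M.amp n ≤ M.A₀ * ((9718 : ℝ) / 10000) ^ n := by
  induction n with
  | zero => simp [amp_zero]
  | succ n ih =>
    rw [amp_succ, pow_succ, ← mul_assoc]
    exact mul_le_mul ih (M.lev_bounds n).2 (M.lev_pos n).le (by have := M.hA₀; positivity)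

/-- **Growth of the level-weighted amplitude**: `ΛKⁿ · amp n ≥ A₀ · 5ⁿ`. [folklore] -/
theorem growth (n : ℕ) : M.A₀ * 5 ^ n ≤ ΛK ^ n * M.amp n := by
  have h1 : (5 : ℝ) ^ n ≤ (ΛK * (9673 / 10000)) ^ n :=
    pow_le_pow_left₀ (by norm_num) (by have := ΛK_ge; nlinarith) n
  calc M.A₀ * 5 ^ n ≤ M.A₀ * (ΛK * (9673 / 10000)) ^ n :=
        mul_le_mul_of_nonneg_left h1 M.hA₀.le
    _ = ΛK ^ n * (M.A₀ * (9673 / 10000) ^ n) := by rw [mul_pow]; ring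
    _ ≤ ΛK ^ n * M.amp n := mul_le_mul_of_nonneg_left (M.amp_ge n) (pow_pos ΛK_pos n).le

/-- [folklore] -/
theorem dur_pos (n : ℕ) : 0 < M.dur n := by
  have hτ := M.τs_window n
  have : 0 < M.τs n := by have := (abs_le.mp hτ).1; linarith
  exact div_pos this (mul_pos (M.amp_pos n) (pow_pos ΛK_pos n))

/-- `dur n ≤ (0.956/A₀) · 5⁻ⁿ`. [folklore] -/
theorem dur_le (n : ℕ) : M.dur n ≤ (239 : ℝ) / 250 / M.A₀ * (1 / 5) ^ n := by
  have hτ : M.τs n ≤ 239 / 250 := by have := (abs_le.mp (M.τs_window n)).2; linarith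
  have hg := M.growth n
  have hA := M.hA₀
  have hden : 0 < M.amp n * ΛK ^ n := mul_pos (M.amp_pos n) (pow_pos ΛK_pos n)
  have h5 : (0 : ℝ) < 5 ^ n := pow_pos (by norm_num) n
  have key : M.τs n / (M.amp n * ΛK ^ n) ≤ 239 / 250 / (M.A₀ * 5 ^ n) := by
    rw [div_le_div_iff₀ hden (mul_pos hA h5)]
    calc M.τs n * (M.A₀ * 5 ^ n) ≤ 239 / 250 * (ΛK ^ n * M.amp n) :=
          mul_le_mul hτ hg (by positivity) (by norm_num)
      _ = 239 / 250 * (M.amp n * ΛK ^ n) := by ring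
  calc M.dur n = M.τs n / (M.amp n * ΛK ^ n) := rfl
    _ ≤ 239 / 250 / (M.A₀ * 5 ^ n) := key
    _ = 239 / 250 / M.A₀ * (1 / 5) ^ n := by
        rw [one_div_pow, div_mul_div_comm, mul_one, div_div]

/-- [folklore] -/
theorem clock_zero : M.clock 0 = 0 := rfl

/-- [folklore] -/
theorem clock_succ (n : ℕ) : M.clock (n + 1) = M.clock n + M.dur n := rfl

/-- [folklore] -/
theorem clock_eq_sum (N : ℕ) : M.clock N = ∑ n ∈ range N, M.dur n := by
  induction N with
  | zero => simp [clock_zero]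
  | succ N ih => rw [clock_succ, sum_range_succ, ih]

/-- [folklore] -/
theorem clock_mono : Monotone M.clock :=
  monotone_nat_of_le_succ fun n => by rw [clock_succ]; exact (lt_add_of_pos_right _ (M.dur_pos n)).le

/-- **Finite time**: every window starts before physical time `1.2/A₀`. [folklore] -/
theorem clock_le (N : ℕ) : M.clock N ≤ 6 / 5 / M.A₀ := by
  have hA := M.hA₀
  have hgeom : ∑ n ∈ range N, ((1 : ℝ) / 5) ^ n ≤ 5 / 4 := by
    have h := geom_sum_Ico_le_of_lt_one (show (0 : ℝ) ≤ 1 / 5 by norm_num)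
      (show (1 : ℝ) / 5 < 1 by norm_num) (m := 0) (n := N)
    simp only [pow_zero] at h
    rw [range_eq_Ico]
    linarith [show (1 : ℝ) / (1 - 1 / 5) = 5 / 4 by norm_num]
  calc M.clock N = ∑ n ∈ range N, M.dur n := M.clock_eq_sum N
    _ ≤ ∑ n ∈ range N, (239 : ℝ) / 250 / M.A₀ * (1 / 5) ^ n := sum_le_sum fun n _ => M.dur_le n
    _ = 239 / 250 / M.A₀ * ∑ n ∈ range N, ((1 : ℝ) / 5) ^ n := by rw [mul_sum]
    _ ≤ 239 / 250 / M.A₀ * (5 / 4) := mul_le_mul_of_nonneg_left hgeom (by positivity)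
    _ ≤ 6 / 5 / M.A₀ := by
        rw [div_mul_eq_mul_div, div_le_div_iff_of_pos_right hA]; norm_num

/-! ### The physical windows -/

/-- **Window `n` solves the scale-`n` equations** `ẇ = ΛKⁿ • F(w)`. [folklore] -/
theorem win_solves (n : ℕ) : ∀ t, HasDerivAt (M.win n) (ΛK ^ n • F gK ΛK (M.win n t)) t :=
  solution_speed (solution_smul (M.ysol_solves n) (M.amp n)) (ΛK ^ n)

/-- [folklore] -/
theorem win_start (n : ℕ) : M.win n 0 = M.amp n • (M.traj n).1 := by
  simp [win, M.ysol_start n]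

/-- Energy is conserved inside each window. [folklore] -/
theorem win_energy (n : ℕ) (t : ℝ) : ∑ a, M.win n t a ^ 2 = M.amp n ^ 2 * ∑ a, (M.traj n).1 a ^ 2 := by
  simp only [win, Pi.smul_apply, smul_eq_mul, mul_pow, ← mul_sum,
    energy_conserved (M.ysol_solves n), M.ysol_start n]

/-- At its physical duration window `n` sits at its (unit-scale) section state, scaled. [folklore] -/
theorem win_end (n : ℕ) : M.win n (M.dur n) = M.amp n • M.ysol n (M.τs n) := by
  have hA : M.amp n ≠ 0 := (M.amp_pos n).ne'
  have hΛ : ΛK ^ n ≠ 0 := (pow_pos ΛK_pos n).ne'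
  have ht : M.amp n * (ΛK ^ n * (M.τs n / (M.amp n * ΛK ^ n))) = M.τs n := by field_simp
  simp only [win, dur, ht]

/-- **Hand-over consistency, old gate**: in physical units the first gate of window `n+1` at its
start is the second gate of window `n` at its section time: `a₁' = a₂, b₁' = b₂, c₁' = c₂,
d₁' = d₂` and the next-carrier seed `a₂' = e₂`. [folklore] -/
theorem handover (n : ℕ) :
    M.win (n + 1) 0 0 = M.win n (M.dur n) 4 ∧ M.win (n + 1) 0 1 = M.win n (M.dur n) 5 ∧
    M.win (n + 1) 0 2 = M.win n (M.dur n) 6 ∧ M.win (n + 1) 0 3 = M.win n (M.dur n) 7 ∧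
    M.win (n + 1) 0 4 = M.win n (M.dur n) 8 := by
  have h4 : M.ysol n (M.τs n) 4 ≠ 0 := (M.a₂_pos n).ne'
  have hX : X0 0 ≠ 0 := X0_zero_pos.ne'
  have h0 : ((X0Q 0 : ℚ) : ℝ) ≠ 0 := by exact_mod_cast X0Q_ne.1
  have hsec := M.on_section n
  have hr : (secCert.rho : ℝ) = (X0Q 1 : ℝ) / X0Q 0 := by
    show ((X0Q 1 / X0Q 0 : ℚ) : ℝ) = _; push_cast; rfl
  rw [M.win_end n, M.win_start (n + 1), M.traj_succ n, M.amp_succ n]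
  simp only [Pi.smul_apply, smul_eq_mul, renorm, lev, Matrix.cons_val_zero, Matrix.cons_val_one]
  refine ⟨?_, ?_, ?_, ?_, ?_⟩
  · field_simp
  · rw [hsec, hr, X0_eq, X0_eq]; field_simp
  · show M.amp n * (M.ysol n (M.τs n) 4 / X0 0) *
        (![X0 0, X0 1, X0 0 * M.ysol n (M.τs n) 6 / M.ysol n (M.τs n) 4,
          X0 0 * M.ysol n (M.τs n) 7 / M.ysol n (M.τs n) 4,
          X0 0 * M.ysol n (M.τs n) 8 / M.ysol n (M.τs n) 4, M.qm n 0, M.qm n 1, M.qm n 2,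
          M.qm n 3] : Fin 9 → ℝ) 2 = M.amp n * M.ysol n (M.τs n) 6
    simp; field_simp
  · show M.amp n * (M.ysol n (M.τs n) 4 / X0 0) *
        (![X0 0, X0 1, X0 0 * M.ysol n (M.τs n) 6 / M.ysol n (M.τs n) 4,
          X0 0 * M.ysol n (M.τs n) 7 / M.ysol n (M.τs n) 4,
          X0 0 * M.ysol n (M.τs n) 8 / M.ysol n (M.τs n) 4, M.qm n 0, M.qm n 1, M.qm n 2,
          M.qm n 3] : Fin 9 → ℝ) 3 = M.amp n * M.ysol n (M.τs n) 7
    simp; field_simp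
  · show M.amp n * (M.ysol n (M.τs n) 4 / X0 0) *
        (![X0 0, X0 1, X0 0 * M.ysol n (M.τs n) 6 / M.ysol n (M.τs n) 4,
          X0 0 * M.ysol n (M.τs n) 7 / M.ysol n (M.τs n) 4,
          X0 0 * M.ysol n (M.τs n) 8 / M.ysol n (M.τs n) 4, M.qm n 0, M.qm n 1, M.qm n 2,
          M.qm n 3] : Fin 9 → ℝ) 4 = M.amp n * M.ysol n (M.τs n) 8
    simp; field_simp

/-- **Hand-over consistency, fresh gate**: the second gate of window `n+1` starts at the quiet
modes `qm n`, at the new physical amplitude. [folklore] -/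
theorem handover_fresh (n : ℕ) (m : Fin 4) :
    M.win (n + 1) 0 ⟨5 + m, by omega⟩ = M.amp (n + 1) * M.qm n m := by
  rw [M.win_start (n + 1), M.traj_succ n]
  simp only [Pi.smul_apply, smul_eq_mul, renorm]
  fin_cases m <;> rfl

/-- **THE TOY MACHINE** (summary): given the re-entry certificate, every quiet environment, start
state in `reBox` and amplitude `A₀ > 0` generate infinitely many exact windows, window `n` solving
the scale-`n` circuit equations and handing its second gate over to window `n+1`'s first, all of
them starting before physical time `1.2/A₀`, with level-weighted amplitude `ΛKⁿ·amp n ≥ A₀·5ⁿ`.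
[folklore] -/
theorem machine (M : MachineData) :
    (∀ n, ∀ b, |(M.traj n).1 b - (reBox.cen b : ℝ)| ≤ reBox.rad b) ∧
    (∀ n t, HasDerivAt (M.win n) (ΛK ^ n • F gK ΛK (M.win n t)) t) ∧
    (∀ n, M.win n 0 = M.amp n • (M.traj n).1) ∧
    (∀ n, M.win (n + 1) 0 0 = M.win n (M.dur n) 4 ∧ M.win (n + 1) 0 1 = M.win n (M.dur n) 5 ∧
      M.win (n + 1) 0 2 = M.win n (M.dur n) 6 ∧ M.win (n + 1) 0 3 = M.win n (M.dur n) 7 ∧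
      M.win (n + 1) 0 4 = M.win n (M.dur n) 8) ∧
    (∀ n, 0 < M.dur n) ∧ (∀ N, M.clock N ≤ 6 / 5 / M.A₀) ∧ (∀ n, M.A₀ * 5 ^ n ≤ ΛK ^ n * M.amp n) :=
  ⟨M.traj_mem, M.win_solves, M.win_start, M.handover, M.dur_pos, M.clock_le, M.growth⟩

end MachineData

/-- **Existence of a machine run from every admissible datum**, as one statement over the
re-entry certificate. [folklore] -/
theorem machine_of (hre : reentryOK (row 0) reBox = true) (qm : ℕ → Fin 4 → ℝ)
    (hqm : ∀ n m, |qm n m - (Q1C m : ℝ)| ≤ Q1W m) (q₀ : Fin 9 → ℝ)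
    (hq : ∀ b, |q₀ b - (reBox.cen b : ℝ)| ≤ reBox.rad b) {A₀ : ℝ} (hA₀ : 0 < A₀) :
    ∃ (w : ℕ → ℝ → Fin 9 → ℝ) (A d S : ℕ → ℝ),
      w 0 0 = A₀ • q₀ ∧ A 0 = A₀ ∧ S 0 = 0 ∧
      (∀ n t, HasDerivAt (w n) (ΛK ^ n • F gK ΛK (w n t)) t) ∧
      (∀ n, ∃ q : Fin 9 → ℝ, (∀ b, |q b - (reBox.cen b : ℝ)| ≤ reBox.rad b) ∧ w n 0 = A n • q) ∧
      (∀ n, w (n + 1) 0 0 = w n (d n) 4 ∧ w (n + 1) 0 1 = w n (d n) 5 ∧ w (n + 1) 0 2 = w n (d n) 6 ∧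
        w (n + 1) 0 3 = w n (d n) 7 ∧ w (n + 1) 0 4 = w n (d n) 8) ∧
      (∀ n (m : Fin 4), w (n + 1) 0 ⟨5 + m, by omega⟩ = A (n + 1) * qm n m) ∧
      (∀ n, 0 < d n ∧ S (n + 1) = S n + d n) ∧ (∀ N, S N ≤ 6 / 5 / A₀) ∧
      (∀ n, A₀ * 5 ^ n ≤ ΛK ^ n * A n) := by
  let M : MachineData := ⟨hre, qm, hqm, ⟨q₀, hq⟩, A₀, hA₀⟩
  refine ⟨M.win, M.amp, M.dur, M.clock, ?_, rfl, rfl, M.win_solves, fun n => ⟨(M.traj n).1,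
    M.traj_mem n, M.win_start n⟩, M.handover, M.handover_fresh, fun n => ⟨M.dur_pos n, rfl⟩,
    M.clock_le, M.growth⟩
  rw [M.win_start 0]; rfl

end RowChain

end Summit.NavierStokesRegularity.FluidComputer
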